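import Mathlib.Analysis.InnerProductSpace.PiL2
import Mathlib.Analysis.Complex.Basic
import Mathlib.Geometry.Manifold.ChartedSpace
import Mathlib.Tactic

/-!
# Level sets of the wedge coordinate `T_V` are flat two-chart spheres, and compact
(registered helpers `helper_wedgeLevelSetV` and `helper_wedgeLevelCompactV` of line
`cross-cap-laurent`, crux `GromovRecognitionRelEnd`, item stmt-SmoothPoincare4-11009)

This is the `V`-side mirror of `SymplecticOrigamiGromovRecognitionRelEndWedgeLevelH`: the roles
of the two complex factors `(p 0, p 1)` and `(p 2, p 3)` of `ℝ⁴ = ℂ²` and of the charts `ηH`,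
`ηV` are exchanged.

In the wedge cap `X` the chart `ηV : ℝ⁴ → X` lives on the open polydisc
`D_V = {|(p 0, p 1)| < R₁⁻¹}` and the corner chart `ηC : ℝ⁴ → X` on the bidisc
`D_C = {|(p 0, p 1)| < R₁⁻¹, |(p 2, p 3)| < R₁⁻¹}`; the two are glued by complex inversion of the
second factor, `ηC (s, w) = ηV (s, 1/w)` for `w ≠ 0`.  The coordinate `T : X → ℂ` of
`helper_wedgeCoordinateV` reads the first complex factor through both charts:
`T (ηV p) = p 0 + i p 1` on `D_V` and `T (ηC p) = p 0 + i p 1` on `D_C`.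

* `helper_wedgeLevelSetV`: for `‖s‖ < R₁⁻¹` the level set `{y ∈ ηV '' D_V ∪ ηC '' D_C | T y = s}`
  is the flat leaf `w ↦ ηV (s, w)` closed up by the single point `ηC (s, 0)`.  Pure set algebra:
  a point `ηV p` of the level set has `(p 0, p 1) = (s.re, s.im)`, so it is `ηV (s, w)` with
  `w = p 2 + i p 3`; a point `ηC p` of the level set is `ηV (s, 1/w)` by the gluing clause if
  `w = p 2 + i p 3 ≠ 0`, and the extra point if `w = 0`; conversely `(s, w) ∈ D_V` and
  `(s, 0) ∈ D_C` since `s.re ^ 2 + s.im ^ 2 = ‖s‖ ^ 2 < R₁⁻¹ ^ 2`.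
* `helper_wedgeLevelCompactV`: the level set is compact.  With `r = R₁ + 1 > R₁` it equals
  `ηV ({s} × (closed ball of radius r)) ∪ ηC ({s} × (closed ball of radius r⁻¹))`: a point
  `ηV (s, w)` with `‖w‖ > r` is `ηC (s, 1/w)` by the gluing clause (`‖1/w‖ < r⁻¹ < R₁⁻¹`), and the
  extra point is `ηC (s, 0)`; both pieces are continuous images of compact balls (the slices lie
  in `D_V`, resp. `D_C`, where `ηV`, resp. `ηC`, is continuous).

Everything is proved from Mathlib topology; no definition, no named fact.
-/

-- the registered namespace `Summit.SmoothPoincare4.SmoothPoincare4.Theorems…` repeats a component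
set_option linter.dupNamespace false

open Set Metric

namespace Summit.SmoothPoincare4.SmoothPoincare4.Theorems.GromovRecognitionRelEnd.CrossCapLaurent

/-- For `‖s‖ < R₁⁻¹`, the real coordinates of `s` lie in the disc of radius `R₁⁻¹`:
`s.re ^ 2 + s.im ^ 2 < R₁⁻¹ ^ 2` (`V`-side copy). -/
private lemma wedgeLevelV_re_sq_add_im_sq_lt {R₁ : ℝ} {s : ℂ} (hs : ‖s‖ < R₁⁻¹) :
    s.re ^ 2 + s.im ^ 2 < R₁⁻¹ ^ 2 := by
  have h : s.re ^ 2 + s.im ^ 2 = ‖s‖ ^ 2 := by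
    rw [← Complex.normSq_eq_norm_sq, Complex.normSq_apply]
    ring
  rw [h]
  exact pow_lt_pow_left₀ hs (norm_nonneg s) two_ne_zero

/-- **Level sets of the wedge coordinate `T_V` are flat leaves closed up by one point.**  Given the
gluing clause `ηC p = ηV (p 0, p 1, complex inverse of (p 2, p 3))` off the axis `p 2 = p 3 = 0`
and a coordinate `T` with `T (ηV p) = p 0 + i p 1` on the polydisc `{p 0 ^ 2 + p 1 ^ 2 < R₁⁻¹ ^ 2}`
and `T (ηC p) = p 0 + i p 1` on the bidisc `{p 0 ^ 2 + p 1 ^ 2 < R₁⁻¹ ^ 2, p 2 ^ 2 + p 3 ^ 2 <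
R₁⁻¹ ^ 2}`, for every `s` with `‖s‖ < R₁⁻¹` the level set `{T = s}` inside the union of the two
chart images is `{ηV (s, w) | w : ℂ} ∪ {ηC (s, 0)}`. -/
theorem helper_wedgeLevelSetV : ∀ (X : Type) (R₁ : ℝ) (ηV ηC : EuclideanSpace ℝ (Fin 4) → X)
    (T : X → ℂ), 0 < R₁ →
    (∀ p : EuclideanSpace ℝ (Fin 4), p 0 ^ 2 + p 1 ^ 2 < R₁⁻¹ ^ 2 → p 2 ^ 2 + p 3 ^ 2 < R₁⁻¹ ^ 2 →
      (p 2 ≠ 0 ∨ p 3 ≠ 0) →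
      ηC p = ηV (WithLp.toLp 2 ![p 0, p 1, p 2 / (p 2 ^ 2 + p 3 ^ 2), -(p 3) / (p 2 ^ 2 + p 3 ^ 2)])) →
    (∀ p : EuclideanSpace ℝ (Fin 4), p 0 ^ 2 + p 1 ^ 2 < R₁⁻¹ ^ 2 → T (ηV p) = ⟨p 0, p 1⟩) →
    (∀ p : EuclideanSpace ℝ (Fin 4), p 0 ^ 2 + p 1 ^ 2 < R₁⁻¹ ^ 2 → p 2 ^ 2 + p 3 ^ 2 < R₁⁻¹ ^ 2 →
      T (ηC p) = ⟨p 0, p 1⟩) →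
    ∀ s : ℂ, ‖s‖ < R₁⁻¹ →
      {y : X | y ∈ (ηV '' {p : EuclideanSpace ℝ (Fin 4) | p 0 ^ 2 + p 1 ^ 2 < R₁⁻¹ ^ 2} ∪
          ηC '' {p : EuclideanSpace ℝ (Fin 4) | p 0 ^ 2 + p 1 ^ 2 < R₁⁻¹ ^ 2 ∧
            p 2 ^ 2 + p 3 ^ 2 < R₁⁻¹ ^ 2}) ∧ T y = s} =
        Set.range (fun w : ℂ => ηV (WithLp.toLp 2 ![s.re, s.im, w.re, w.im])) ∪
          {ηC (WithLp.toLp 2 ![s.re, s.im, 0, 0])} := by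
  intro X R₁ ηV ηC T hR₁ hglue hTV hTC s hs
  have hR : (0 : ℝ) < R₁⁻¹ ^ 2 := by positivity
  have hss : s.re ^ 2 + s.im ^ 2 < R₁⁻¹ ^ 2 := wedgeLevelV_re_sq_add_im_sq_lt hs
  ext y
  simp only [mem_setOf_eq, mem_union, mem_range, mem_singleton_iff]
  constructor
  · rintro ⟨hy | hy, hT0⟩
    · -- `y = ηV p` with `(p 0, p 1) = (s.re, s.im)`: a point of the flat leaf `ηV ({s} × ℂ)`
      obtain ⟨p, hp, rfl⟩ := hy
      rw [hTV p hp] at hT0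
      have h0 : p 0 = s.re := by simpa using congrArg Complex.re hT0
      have h1 : p 1 = s.im := by simpa using congrArg Complex.im hT0
      refine Or.inl ⟨⟨p 2, p 3⟩, ?_⟩
      show ηV _ = ηV p
      congr 1
      ext i
      fin_cases i <;> simp [h0, h1]
    · -- `y = ηC p` with `(p 0, p 1) = (s.re, s.im)`: off the second axis `ηC p = ηV (s, 1 / w)`,
      -- on the axis `p = (s, 0)`
      obtain ⟨p, hp, rfl⟩ := hy
      rw [hTC p hp.1 hp.2] at hT0
      have h0 : p 0 = s.re := by simpa using congrArg Complex.re hT0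
      have h1 : p 1 = s.im := by simpa using congrArg Complex.im hT0
      by_cases h23 : p 2 ≠ 0 ∨ p 3 ≠ 0
      · refine Or.inl ⟨⟨p 2 / (p 2 ^ 2 + p 3 ^ 2), -(p 3) / (p 2 ^ 2 + p 3 ^ 2)⟩, ?_⟩
        show ηV _ = ηC p
        rw [hglue p hp.1 hp.2 h23]
        congr 1
        ext i
        fin_cases i <;> simp [h0, h1]
      · simp only [not_or, not_not] at h23
        have hp0 : p = WithLp.toLp 2 ![s.re, s.im, 0, 0] := by
          ext i
          fin_cases i <;> simp [h23.1, h23.2, h0, h1]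
        exact Or.inr (congrArg ηC hp0)
  · rintro (⟨w, rfl⟩ | rfl)
    · -- the flat leaf: `ηV (s, w) ∈ ηV '' D_V` and `T = s.re + i s.im = s` there
      have hmem : (WithLp.toLp 2 ![s.re, s.im, w.re, w.im] : EuclideanSpace ℝ (Fin 4)) ∈
          {p : EuclideanSpace ℝ (Fin 4) | p 0 ^ 2 + p 1 ^ 2 < R₁⁻¹ ^ 2} := by
        simpa using hss
      exact ⟨Or.inl ⟨_, hmem, rfl⟩, by rw [hTV _ hmem]; simp⟩
    · -- the closing point `ηC (s, 0)`, with `(s, 0) ∈ D_C`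
      have hmem : (WithLp.toLp 2 ![s.re, s.im, 0, 0] : EuclideanSpace ℝ (Fin 4)) ∈
          {p : EuclideanSpace ℝ (Fin 4) | p 0 ^ 2 + p 1 ^ 2 < R₁⁻¹ ^ 2 ∧
            p 2 ^ 2 + p 3 ^ 2 < R₁⁻¹ ^ 2} := by
        rw [mem_setOf_eq]
        exact ⟨by simpa using hss, by simpa using hR⟩
      exact ⟨Or.inr ⟨_, hmem, rfl⟩, by rw [hTC _ hmem.1 hmem.2]; simp⟩

/-- **Level sets of the wedge coordinate `T_V` are compact.**  For a Hausdorff space `X`, a chart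
`ηV` continuous on the polydisc `{p 0 ^ 2 + p 1 ^ 2 < R₁⁻¹ ^ 2}`, a corner chart `ηC` continuous on
the bidisc `{p 0 ^ 2 + p 1 ^ 2 < R₁⁻¹ ^ 2, p 2 ^ 2 + p 3 ^ 2 < R₁⁻¹ ^ 2}`, the gluing clause
`ηC p = ηV (p 0, p 1, complex inverse of (p 2, p 3))` off the axis `p 2 = p 3 = 0`, and a
coordinate `T` reading `p 0 + i p 1` through both charts, every level set `{T = s}`,
`‖s‖ < R₁⁻¹`, inside the union of the two chart images is compact: by `helper_wedgeLevelSetV` it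
is `{ηV (s, w)} ∪ {ηC (s, 0)}`, which is the union of the continuous images of the compact slices
`{s} × closedBall 0 (R₁ + 1)` under `ηV` and `{s} × closedBall 0 (R₁ + 1)⁻¹` under `ηC`. -/
theorem helper_wedgeLevelCompactV : ∀ (X : Type) [TopologicalSpace X] [T2Space X]
    [ChartedSpace (EuclideanSpace ℝ (Fin 4)) X] (R₁ : ℝ) (ηV ηC : EuclideanSpace ℝ (Fin 4) → X)
    (T : X → ℂ), 0 < R₁ →
    ContinuousOn ηV {p : EuclideanSpace ℝ (Fin 4) | p 0 ^ 2 + p 1 ^ 2 < R₁⁻¹ ^ 2} →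
    ContinuousOn ηC {p : EuclideanSpace ℝ (Fin 4) | p 0 ^ 2 + p 1 ^ 2 < R₁⁻¹ ^ 2 ∧
      p 2 ^ 2 + p 3 ^ 2 < R₁⁻¹ ^ 2} →
    (∀ p : EuclideanSpace ℝ (Fin 4), p 0 ^ 2 + p 1 ^ 2 < R₁⁻¹ ^ 2 → p 2 ^ 2 + p 3 ^ 2 < R₁⁻¹ ^ 2 →
      (p 2 ≠ 0 ∨ p 3 ≠ 0) →
      ηC p = ηV (WithLp.toLp 2 ![p 0, p 1, p 2 / (p 2 ^ 2 + p 3 ^ 2), -(p 3) / (p 2 ^ 2 + p 3 ^ 2)])) →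
    (∀ p : EuclideanSpace ℝ (Fin 4), p 0 ^ 2 + p 1 ^ 2 < R₁⁻¹ ^ 2 → T (ηV p) = ⟨p 0, p 1⟩) →
    (∀ p : EuclideanSpace ℝ (Fin 4), p 0 ^ 2 + p 1 ^ 2 < R₁⁻¹ ^ 2 → p 2 ^ 2 + p 3 ^ 2 < R₁⁻¹ ^ 2 →
      T (ηC p) = ⟨p 0, p 1⟩) →
    ∀ s : ℂ, ‖s‖ < R₁⁻¹ →
      IsCompact {y : X | y ∈ (ηV '' {p : EuclideanSpace ℝ (Fin 4) | p 0 ^ 2 + p 1 ^ 2 < R₁⁻¹ ^ 2} ∪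
          ηC '' {p : EuclideanSpace ℝ (Fin 4) | p 0 ^ 2 + p 1 ^ 2 < R₁⁻¹ ^ 2 ∧
            p 2 ^ 2 + p 3 ^ 2 < R₁⁻¹ ^ 2}) ∧ T y = s} := by
  intro X _ _ _ R₁ ηV ηC T hR₁ hV hC hglue hTV hTC s hs
  rw [helper_wedgeLevelSetV X R₁ ηV ηC T hR₁ hglue hTV hTC s hs]
  -- the slice `e w = (s, w)` of the second complex factor over the base point `s`
  set e : ℂ → EuclideanSpace ℝ (Fin 4) := fun w => WithLp.toLp 2 ![s.re, s.im, w.re, w.im]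
    with he_def
  have he : Continuous e := by
    refine (PiLp.continuous_toLp 2 _).comp (continuous_pi fun i => ?_)
    fin_cases i
    · exact continuous_const
    · exact continuous_const
    · exact Complex.continuous_re
    · exact Complex.continuous_im
  have he0 : ∀ w : ℂ, e w 0 = s.re := fun w => by simp [he_def]
  have he1 : ∀ w : ℂ, e w 1 = s.im := fun w => by simp [he_def]
  have he2 : ∀ w : ℂ, e w 2 = w.re := fun w => by simp [he_def]
  have he3 : ∀ w : ℂ, e w 3 = w.im := fun w => by simp [he_def]
  have he_zero : e 0 = WithLp.toLp 2 ![s.re, s.im, 0, 0] := by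
    simp [he_def]
  -- radii: `r = R₁ + 1 > R₁`, so `r⁻¹ < R₁⁻¹`
  set r : ℝ := R₁ + 1 with hr_def
  have hr : 0 < r := by linarith
  have hrR : r⁻¹ < R₁⁻¹ := inv_strictAnti₀ hR₁ (by linarith)
  have hrR2 : r⁻¹ ^ 2 < R₁⁻¹ ^ 2 := pow_lt_pow_left₀ hrR (inv_pos.mpr hr).le two_ne_zero
  -- the slice lies in the two polydiscs
  have hss : s.re ^ 2 + s.im ^ 2 < R₁⁻¹ ^ 2 := wedgeLevelV_re_sq_add_im_sq_lt hs
  have hnorm : ∀ w : ℂ, e w 2 ^ 2 + e w 3 ^ 2 = ‖w‖ ^ 2 := fun w => by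
    rw [he2, he3, ← Complex.normSq_eq_norm_sq, Complex.normSq_apply]
    ring
  have hsmall : ∀ w : ℂ, ‖w‖ ≤ r⁻¹ → e w 2 ^ 2 + e w 3 ^ 2 < R₁⁻¹ ^ 2 := fun w hw => by
    rw [hnorm]
    calc ‖w‖ ^ 2 ≤ r⁻¹ ^ 2 := by gcongr
      _ < R₁⁻¹ ^ 2 := hrR2
  have hfst : ∀ w : ℂ, e w 0 ^ 2 + e w 1 ^ 2 < R₁⁻¹ ^ 2 := fun w => by
    rw [he0, he1]
    exact hss
  -- the gluing clause on the slice: `ηC (s, w) = ηV (s, 1/w)` for `0 < ‖w‖ ≤ r⁻¹`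
  have hglue' : ∀ w : ℂ, w ≠ 0 → ‖w‖ ≤ r⁻¹ → ηC (e w) = ηV (e w⁻¹) := by
    intro w hw hwr
    have hne : e w 2 ≠ 0 ∨ e w 3 ≠ 0 := by
      rw [he2, he3]
      by_contra h
      push Not at h
      exact hw (Complex.ext (by simpa using h.1) (by simpa using h.2))
    have hsq : w.re ^ 2 + w.im ^ 2 = Complex.normSq w := by
      rw [Complex.normSq_apply]
      ring
    have hinv : e w⁻¹ = WithLp.toLp 2
        ![e w 0, e w 1, e w 2 / (e w 2 ^ 2 + e w 3 ^ 2), -(e w 3) / (e w 2 ^ 2 + e w 3 ^ 2)] := by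
      rw [he0, he1, he2, he3, hsq]
      change WithLp.toLp 2 ![s.re, s.im, (w⁻¹).re, (w⁻¹).im] = _
      rw [Complex.inv_re, Complex.inv_im]
    rw [hinv]
    exact hglue (e w) (hfst w) (hsmall w hwr) hne
  -- the two compact pieces
  have hK₁ : IsCompact ((ηV ∘ e) '' closedBall (0 : ℂ) r) :=
    (isCompact_closedBall (0 : ℂ) r).image_of_continuousOn
      (hV.comp he.continuousOn fun w _ => hfst w)
  have hK₂ : IsCompact ((ηC ∘ e) '' closedBall (0 : ℂ) r⁻¹) :=
    (isCompact_closedBall (0 : ℂ) r⁻¹).image_of_continuousOn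
      (hC.comp he.continuousOn fun w hw => ⟨hfst w, hsmall w (mem_closedBall_zero_iff.mp hw)⟩)
  -- the level set is their union
  have hEq : Set.range (fun w : ℂ => ηV (WithLp.toLp 2 ![s.re, s.im, w.re, w.im])) ∪
      {ηC (WithLp.toLp 2 ![s.re, s.im, 0, 0])} =
      (ηV ∘ e) '' closedBall (0 : ℂ) r ∪ (ηC ∘ e) '' closedBall (0 : ℂ) r⁻¹ := by
    apply Set.Subset.antisymm
    · rintro y (⟨w, rfl⟩ | rfl)
      · change ηV (e w) ∈ _
        by_cases hw : ‖w‖ ≤ r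
        · exact Or.inl ⟨w, mem_closedBall_zero_iff.mpr hw, rfl⟩
        · push Not at hw
          have hw0 : w ≠ 0 := norm_pos_iff.mp (hr.trans hw)
          have hwr : ‖w⁻¹‖ ≤ r⁻¹ := by
            rw [norm_inv]
            exact inv_anti₀ hr hw.le
          refine Or.inr ⟨w⁻¹, mem_closedBall_zero_iff.mpr hwr, ?_⟩
          change ηC (e w⁻¹) = ηV (e w)
          rw [hglue' w⁻¹ (inv_ne_zero hw0) hwr, inv_inv]
      · refine Or.inr ⟨0, mem_closedBall_self (inv_pos.mpr hr).le, ?_⟩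
        change ηC (e 0) = ηC (WithLp.toLp 2 ![s.re, s.im, 0, 0])
        rw [he_zero]
    · rintro y (⟨w, -, rfl⟩ | ⟨w, hw, rfl⟩)
      · exact Or.inl ⟨w, rfl⟩
      · by_cases hw0 : w = 0
        · subst hw0
          right
          change ηC (e 0) ∈ ({ηC (WithLp.toLp 2 ![s.re, s.im, 0, 0])} : Set X)
          rw [he_zero]
          exact Set.mem_singleton _
        · left
          refine ⟨w⁻¹, ?_⟩
          change ηV (e w⁻¹) = ηC (e w)
          exact (hglue' w hw0 (mem_closedBall_zero_iff.mp hw)).symm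
  rw [hEq]
  exact hK₁.union hK₂

end Summit.SmoothPoincare4.SmoothPoincare4.Theorems.GromovRecognitionRelEnd.CrossCapLaurent
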